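import Mathlib.CategoryTheory.Widesubcategory
import Mathlib.CategoryTheory.Equivalence
import Literature.AlgebraicGeometry.Frobenioids.CategoriesFactorization
import Literature.AlgebraicGeometry.Frobenioids.Frobenioid
import Literature.AlgebraicGeometry.Frobenioids.CoAngular
import Literature.AlgebraicGeometry.Frobenioids.ElementaryFrobeniusFunctor
import Literature.AlgebraicGeometry.Frobenioids.UnitsFunctor
import HarnessLib

/-!
# Frobenioids I, §2: characteristic splittings, `C(d)`, the unit-linear and unit-wise Frobenius functors (Def. 2.3, Def. 2.4 (iii), Prop. 2.5, Cor. 2.6)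

Mochizuki, *The geometry of Frobenioids I*, Kyushu J. Math. **62** (2008), §2, kurims pp. 47–51
[cite: MochizukiFrdI2008, Def. 2.3 p.47].  Standing data: a Frobenioid `F : C ⥤ ElemFrobenioid Φ`.

* **Def. 2.3** a *characteristic splitting* `τ` on `C`: a subfunctor in monoids of
  `O^▷(−) : (C^istr)^lin → Mon` with (a) `τ(A) → O^▷(A)^char` bijective for `A ∈ Ob(C^istr)` [hence
  a splitting `O^×(A) × τ(A) ⥲ O^▷(A)`, functorial in `A`] and (b) for every isotropic hull
  `A → A^istr`, `τ(A^istr)` lies in the image of `O^▷(A) ↪ O^▷(A^istr)` (Prop. 2.2 (iv)).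
* **Def. 2.4 (iii)** for `d ∈ Λ_{>0}`: `d · Φ ⊆ Φ`, the subcategory `C(d) ⊆ C` of arrows whose
  zero divisor lies in `d · Φ`, and the Frobenius functor `F_Φ → F_Φ`.
* **Prop. 2.5** (`C` of Frobenius-normalized, metrically trivial and `Aut`-ample type): (i) the
  inclusion `O^▷(A)^char ↪ Φ(A)` of Prop. 2.2 (iii) is a bijection — PROVED (`charDiv_bijective`);
  (ii) `C^istr` is of base-trivial type and every object of `C^istr` is Frobenius-trivial —
  statements; (iii) there is an equivalence `Ψ : C ⥲ C(d)`, the *unit-linear Frobenius functor*,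
  acting as the identity on objects and isometries and `1`-compatible with the Frobenius functor on
  `F_Φ` [so that `C(d) → F_{d·Φ}` is a Frobenioid] — statement.  **Remark 2.5.1** is expository.
* **Cor. 2.6** (`d ∈ ℕ_{≥1}`): the *unit-wise Frobenius functor* `Ψ : C → C` with (a)–(d) — statement.

**Rendering.** "Multiplication by `d ∈ Λ_{>0}` on `Φ`" is an endomorphism `δ : Φ → Φ` of the
monoid `Φ` on `D` (`powEnd Φ d` for `Λ = ℤ`; `ElementaryFrobeniusFunctor.lean`); `τ` is a family of
submonoids `τ(A) ⊆ End(A)` whose conditions are imposed on isotropic `A` only; "subfunctor" is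
phrased through the characterising relation `β ∘ φ = φ ∘ α` of `O^▷(φ)` (Prop. 2.2 (ii)(a));
a functor "acting as the identity on objects" is given by its action `map` on arrows.  Proofs of
Prop. 2.5 (ii)(iii) and Cor. 2.6 (pp. 49–51) use Props. 1.9–1.11 (seat L1-t1) and are deferred.
-/

noncomputable section

namespace Literature.AlgebraicGeometry.Frobenioids

open CategoryTheory Opposite

universe w v v' u u'

namespace PreFrobenioid

variable {D : Type u} [Category.{v} D] {Φ : Dᵒᵖ ⥤ CommMonCat.{w}}
  {C : Type u'} [Category.{v'} C] (F : C ⥤ ElemFrobenioid Φ)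

/-! ### Definition 2.3: characteristic splittings -/

/-- **Definition 2.3**: a *characteristic splitting* `τ` on `C` — a subfunctor in monoids
`τ ⊆ O^▷(−)|_{(C^istr)^lin}` such that (a) `τ(A) → O^▷(A)^char` is bijective for every isotropic `A`
and (b) `τ(A^istr)` lies in the image of `O^▷(A) ↪ O^▷(A^istr)` for every isotropic hull
`A → A^istr`.  (The family `τ` is indexed by all objects; only its values on isotropic objects are
constrained or used.) [cite: MochizukiFrdI2008, Def. 2.3 p.47] -/
structure CharacteristicSplitting : Type (max u' v') where
  /-- `τ(A) ⊆ End(A)` -/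
  τ : ∀ A : C, Submonoid (End A)
  /-- `τ(A) ⊆ O^▷(A)` (for isotropic `A`) -/
  τ_le : ∀ {A : C}, IsIsotropic F A → τ A ≤ endSubmonoid F A
  /-- subfunctor of `O^▷(−)` on `(C^istr)^lin`: for a linear `φ : A → B` of `C^istr`, `O^▷(φ)`
  (`β ↦ α` with `β ∘ φ = φ ∘ α`, Prop. 2.2 (ii)(a)) carries `τ(B)` into `τ(A)` -/
  res_mem : ∀ {A B : C}, IsIsotropic F A → IsIsotropic F B → ∀ (φ : A ⟶ B), IsLinear F φ →
    ∀ β ∈ τ B, ∀ α ∈ endSubmonoid F A, φ ≫ β = α ≫ φ → α ∈ τ A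
  /-- (a) `τ(A) → O^▷(A)^char = O^▷(A)/O^×(A)` is bijective -/
  bijective : ∀ {A : C} (hA : IsIsotropic F A),
    Function.Bijective fun t : τ A => Associates.mk (⟨t.1, τ_le hA t.2⟩ : endSubmonoid F A)
  /-- (b) for an isotropic hull `φ : A → A^istr`, every `β ∈ τ(A^istr)` is the image of some
  `α ∈ O^▷(A)` under `O^▷(A) ↪ O^▷(A^istr)` (Prop. 2.2 (iv)), i.e. `β ∘ φ = φ ∘ α` -/
  hull : ∀ {A B : C} (φ : A ⟶ B), IsIsotropicHull F φ →
    ∀ β ∈ τ B, ∃ α ∈ endSubmonoid F A, φ ≫ β = α ≫ φ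

namespace CharacteristicSplitting

variable {F} (τ : CharacteristicSplitting F)

/-- The splitting map `O^×(A) × τ(A) → O^▷(A)`, `(u, t) ↦ u · t` of Def. 2.3 (a)
("hence determines a splitting of monoids"). [cite: MochizukiFrdI2008, Def. 2.3 p.47] -/
def splitMap {A : C} (hA : IsIsotropic F A) (p : unitsSubgroup F A × τ.τ A) : endSubmonoid F A :=
  ⟨(p.1.1.hom : End A), p.1.2⟩ * ⟨p.2.1, τ.τ_le hA p.2.2⟩

/-- **Def. 2.3 (a), the splitting `O^×(A) × τ(A) ⥲ O^▷(A)`** (statement of bijectivity; it follows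
from (a) and total epimorphicity). [cite: MochizukiFrdI2008, Def. 2.3 p.47] -/
def SplittingBijective : Prop :=
  ∀ {A : C} (hA : IsIsotropic F A), Function.Bijective (τ.splitMap hA)

/-- Surjectivity of the splitting `O^×(A) × τ(A) → O^▷(A)`: every `e ∈ O^▷(A)` is `u · t` with
`u ∈ O^×(A)`, `t ∈ τ(A)` (from (a) and `O^×(A) = O^▷(A)^±`, Prop. 2.2 (iii)).
[cite: MochizukiFrdI2008, Def. 2.3 p.47] -/
theorem splitMap_surjective (hF : IsFrobenioid F) {A : C} (hA : IsIsotropic F A) :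
    Function.Surjective (τ.splitMap hA) := by
  intro e
  obtain ⟨t, ht⟩ := (τ.bijective hA).2 (Associates.mk e)
  obtain ⟨w, hw⟩ := Associates.mk_eq_mk_iff_associated.mp ht
  obtain ⟨α, hα, hαw⟩ := (isUnit_endSubmonoid_iff F (w : endSubmonoid F A)).mp w.isUnit
  refine ⟨(⟨α, hα⟩, t), ?_⟩
  rw [← hw]
  change (⟨(α.hom : End A), hα⟩ : endSubmonoid F A) * ⟨t.1, τ.τ_le hA t.2⟩ = _
  rw [endSubmonoid_comm F hF]
  congr 1
  exact Subtype.ext hαw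

/-- Injectivity of the splitting `O^×(A) × τ(A) → O^▷(A)`: from (a) and the fact that every arrow of
`C` is an epimorphism (so `u · t = u' · t` forces `u = u'`). [cite: MochizukiFrdI2008, Def. 2.3 p.47] -/
theorem splitMap_injective (hF : IsFrobenioid F) {A : C} (hA : IsIsotropic F A) :
    Function.Injective (τ.splitMap hA) := by
  rintro ⟨u, t⟩ ⟨u', t'⟩ h
  -- the classes of `t`, `t'` in `O^▷(A)^char` coincide, hence `t = t'` by (a)
  have hcls : Associates.mk (⟨t.1, τ.τ_le hA t.2⟩ : endSubmonoid F A) =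
      Associates.mk (⟨t'.1, τ.τ_le hA t'.2⟩ : endSubmonoid F A) := by
    rw [Associates.mk_eq_mk_iff_associated]
    obtain ⟨w, hw⟩ := (isUnit_endSubmonoid_iff F (⟨(u.1.hom : End A), u.2⟩ : endSubmonoid F A)).mpr
      ⟨u.1, u.2, rfl⟩
    obtain ⟨w', hw'⟩ := (isUnit_endSubmonoid_iff F (⟨(u'.1.hom : End A), u'.2⟩ : endSubmonoid F A)).mpr
      ⟨u'.1, u'.2, rfl⟩
    refine ⟨w * w'⁻¹, ?_⟩
    have h' : (w : endSubmonoid F A) * ⟨t.1, τ.τ_le hA t.2⟩ = (w' : endSubmonoid F A) * ⟨t'.1, τ.τ_le hA t'.2⟩ := by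
      rw [hw, hw']; exact h
    calc (⟨t.1, τ.τ_le hA t.2⟩ : endSubmonoid F A) * ↑(w * w'⁻¹)
        = ((w : endSubmonoid F A) * ⟨t.1, τ.τ_le hA t.2⟩) * ↑(w'⁻¹) := by
          rw [Units.val_mul, ← mul_assoc, endSubmonoid_comm F hF _ (w : endSubmonoid F A)]
      _ = ((w' : endSubmonoid F A) * ⟨t'.1, τ.τ_le hA t'.2⟩) * ↑(w'⁻¹) := by rw [h']
      _ = ⟨t'.1, τ.τ_le hA t'.2⟩ := by
          rw [endSubmonoid_comm F hF (w' : endSubmonoid F A), mul_assoc, Units.mul_inv, mul_one]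
  have ht : t = t' := (τ.bijective hA).1 hcls
  subst ht
  -- now `u · t = u' · t`; `t` is an epimorphism
  have h2 : (show A ⟶ A from t.1) ≫ u.1.hom = (show A ⟶ A from t.1) ≫ u'.1.hom :=
    congrArg (fun e : endSubmonoid F A => (show A ⟶ A from e.1)) h
  haveI := hF.isPreFrobenioid.isTotallyEpimorphic.epi (show A ⟶ A from t.1)
  have hu : u.1 = u'.1 := Iso.ext ((cancel_epi (show A ⟶ A from t.1)).mp h2)
  rw [Prod.mk.injEq]
  exact ⟨Subtype.ext hu, rfl⟩

/-- **Def. 2.3 (a)**: the splitting `O^×(A) × τ(A) ⥲ O^▷(A)` is a bijection (for isotropic `A`, in a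
Frobenioid). [cite: MochizukiFrdI2008, Def. 2.3 p.47] -/
theorem splittingBijective (hF : IsFrobenioid F) : τ.SplittingBijective :=
  fun hA => ⟨τ.splitMap_injective hF hA, τ.splitMap_surjective hF hA⟩

end CharacteristicSplitting

/-! ### Definition 2.4 (iii): the subcategory `C(d)` -/

/-- The arrows of `C(d) ⊆ C`: "the arrows whose zero divisor lies in `d · Φ(−) ⊆ Φ(−)`", for the
endomorphism `δ` = multiplication by `d` (Def. 2.4 (iii)). [cite: MochizukiFrdI2008, Def. 2.4(iii) p.48] -/
def divIn (δ : Φ ⟶ Φ) : MorphismProperty C := fun A _ φ =>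
  Div F φ ∈ imageSubmonoid δ (op (baseObj F A))

/-- `C(d)` contains identities and is closed under composition (Remark 1.1.1 and naturality of
multiplication by `d`), so it is a subcategory. [cite: MochizukiFrdI2008, Def. 2.4(iii) p.48] -/
instance divIn_isMultiplicative (δ : Φ ⟶ Φ) : (divIn F δ).IsMultiplicative where
  id_mem A := by
    show Div F (𝟙 A) ∈ _
    rw [div_id]
    exact one_mem _
  comp_mem φ ψ hφ hψ := by
    show Div F (φ ≫ ψ) ∈ _
    rw [div_comp]
    exact mul_mem (pull_mem_imageSubmonoid δ _ hψ) (pow_mem hφ _)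

/-- **`C(d) ⊆ C`**, the (wide) subcategory determined by the arrows whose zero divisor lies in
`d · Φ` (Def. 2.4 (iii)). [cite: MochizukiFrdI2008, Def. 2.4(iii) p.48] -/
abbrev Cd (δ : Φ ⟶ Φ) : Type u' := WideSubcategory (divIn F δ)

/-- The natural functor `C(d) → F_{d·Φ}` (`Base`, `Div ∈ d · Φ`, `deg_Fr`), Prop. 2.5 (iii)(b).
[cite: MochizukiFrdI2008, Prop. 2.5(iii) p.49] -/
def cdToElem (δ : Φ ⟶ Φ) : Cd F δ ⥤ ElemFrobenioid (imageMonoid δ) where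
  obj A := ElemFrobenioid.of (imageMonoid δ) (baseObj F A.obj)
  map φ := ElemFrobenioid.homMk (Base F φ.1) ⟨Div F φ.1, φ.2⟩ (degFr F φ.1)
  map_id A := ElemFrobenioid.Hom.ext (base_id F A.obj) (Subtype.ext (div_id F A.obj)) (degFr_id F A.obj)
  map_comp φ ψ := ElemFrobenioid.Hom.ext (base_comp F φ.1 ψ.1) (Subtype.ext (div_comp F φ.1 ψ.1))
    (degFr_comp F φ.1 ψ.1)

/-- `C(d) → F_{d·Φ} → D` is `C(d) ⊆ C → D`. [cite: MochizukiFrdI2008, Prop. 2.5(iii) p.49] -/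
theorem cdToElem_comp_baseFunctor (δ : Φ ⟶ Φ) :
    cdToElem F δ ⋙ ElemFrobenioid.baseFunctor (imageMonoid δ) =
      wideSubcategoryInclusion (divIn F δ) ⋙ baseFunctor F := rfl

/-! ### Proposition 2.5 -/

/-- **Prop. 2.5 (i)**: if `A` is metrically trivial and `Aut`-ample then `O^▷(A)^char ↪ Φ(A)`
(Prop. 2.2 (iii)) is surjective: for `x ∈ Φ(A)` take a co-angular pre-step `φ : A → B` with
`Div(φ) = x` (Def. 1.3 (iii)(d)), an isomorphism `B ≅ A` (metric triviality) and correct the base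
by an automorphism of `A` (`Aut`-ampleness). [cite: MochizukiFrdI2008, Prop. 2.5(i) p.48] -/
theorem charDiv_surjective (hF : IsFrobenioid F) {A : C} (hmt : IsMetricallyTrivial F A)
    (haa : IsAutAmple F A) : Function.Surjective (charDiv F hF.isPreFrobenioid A) := by
  intro x
  obtain ⟨B, φ, ⟨hco, hpre⟩, hdiv⟩ := hF.iii_d_under_surj A x
  obtain ⟨e⟩ := hmt φ hco hpre
  obtain ⟨α, hα⟩ :=
    haa (@asIso D _ _ _ (Base F (φ ≫ e.hom)) (IsBaseIso.comp F hpre.2 (isBaseIso_of_isIso F e.hom)))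
  have hαb : Base F α.hom = Base F (φ ≫ e.hom) := congrArg Iso.hom hα
  -- the corrected endomorphism `e₀ := α⁻¹ ∘ e ∘ φ` is base-identity and linear
  have hb : IsBaseIdentity F ((φ ≫ e.hom) ≫ α.inv) := by
    show Base F ((φ ≫ e.hom) ≫ α.inv) = 𝟙 _
    rw [base_comp, ← hαb, ← base_comp, α.hom_inv_id, base_id]
  have hl : IsLinear F ((φ ≫ e.hom) ≫ α.inv) :=
    IsLinear.comp F (IsLinear.comp F hpre.1 (isLinear_of_isIso F e.hom)) (isLinear_of_isIso F α.inv)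
  refine ⟨Associates.mk ⟨(φ ≫ e.hom) ≫ α.inv, hb, hl⟩, ?_⟩
  rw [charDiv_mk, divHom_apply]
  show Div F ((φ ≫ e.hom) ≫ α.inv) = x
  rw [div_comp, div_comp, show Div F α.inv = 1 from isIsometry_of_isIso F hF.isPreFrobenioid α.inv,
    show Div F e.hom = 1 from isIsometry_of_isIso F hF.isPreFrobenioid e.hom, map_one, map_one,
    one_mul, one_mul, show degFr F e.hom = 1 from isLinear_of_isIso F e.hom,
    show degFr F α.inv = 1 from isLinear_of_isIso F α.inv, PNat.one_coe, pow_one, pow_one, hdiv]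

/-- **Prop. 2.5 (i)**: for `C` of metrically trivial and `Aut`-ample type, `O^▷(A)^char ↪ Φ(A)` "is,
in fact, a bijection" (injectivity is Prop. 2.2 (iii)). [cite: MochizukiFrdI2008, Prop. 2.5(i) p.48] -/
theorem charDiv_bijective (hF : IsFrobenioid F) (hmt : IsOfType (IsMetricallyTrivial F))
    (haa : IsOfType (IsAutAmple F)) (A : C) : Function.Bijective (charDiv F hF.isPreFrobenioid A) :=
  ⟨charDiv_injective F hF A, charDiv_surjective F hF (hmt A) (haa A)⟩

/-- **Prop. 2.5 (ii)** (statement): for `C` of Frobenius-normalized, metrically trivial and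
`Aut`-ample type, "`C^istr` is of base-trivial type.  Moreover, every object of `C^istr` is
Frobenius-trivial" (for the pre-Frobenioid structure of `C^istr`, Prop. 1.9 (v)).
[cite: MochizukiFrdI2008, Prop. 2.5(ii) p.48] -/
def IstrBaseTrivialFrobeniusTrivial : Prop :=
  IsFrobenioid F → IsOfType (IsFrobeniusNormalized F) → IsOfType (IsMetricallyTrivial F) →
    IsOfType (IsAutAmple F) →
      IsOfType (IsBaseTrivial ((isotropicObjects F).ι ⋙ F)) ∧
        IsOfType (IsFrobeniusTrivial ((isotropicObjects F).ι ⋙ F))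

/-- The data of a functor `C → C(d)` "acting as the identity on objects and isometries of `C`"
(Prop. 2.5 (iii)(a)): its action on arrows. [cite: MochizukiFrdI2008, Prop. 2.5(iii) p.49] -/
structure UnitLinearFrobeniusData (δ : Φ ⟶ Φ) : Type (max u' v') where
  /-- `φ ↦ Ψ(φ)` -/
  map : ∀ {A B : C}, (A ⟶ B) → (A ⟶ B)
  /-- `Ψ(φ)` lies in `C(d)` -/
  map_mem : ∀ {A B : C} (φ : A ⟶ B), divIn F δ (map φ)
  /-- functoriality: identities -/
  map_id : ∀ A : C, map (𝟙 A) = 𝟙 A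
  /-- functoriality: composites -/
  map_comp : ∀ {X Y Z : C} (φ : X ⟶ Y) (ψ : Y ⟶ Z), map (φ ≫ ψ) = map φ ≫ map ψ
  /-- (a) `Ψ` is the identity on isometries -/
  map_isometry : ∀ {A B : C} (φ : A ⟶ B), IsIsometry F φ → map φ = φ

variable {F} in
/-- The functor `Ψ : C → C(d)` of a `UnitLinearFrobeniusData` (identity on objects).
[cite: MochizukiFrdI2008, Prop. 2.5(iii) p.49] -/
def UnitLinearFrobeniusData.functor {δ : Φ ⟶ Φ} (U : UnitLinearFrobeniusData F δ) : C ⥤ Cd F δ where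
  obj A := ⟨A⟩
  map φ := ⟨U.map φ, U.map_mem φ⟩
  map_id A := WideSubcategory.hom_ext _ (U.map_id A)
  map_comp φ ψ := WideSubcategory.hom_ext _ (U.map_comp φ ψ)

/-- **Prop. 2.5 (iii)** (statement): for a characteristic splitting `τ`, `d ∈ ℕ_{≥1}` (the case
`Λ = ℤ` of "`Λ` a monoid type that supports `Φ`; `d ∈ Λ_{>0}`" — the cases `Λ = ℚ, ℝ` await the
`Λ_{>0}`-actions of Def. 2.4 (ii); TODO(general form)), and `C` of Frobenius-normalized, metrically
trivial and `Aut`-ample type, there exists an equivalence of categories `Ψ : C ⥲ C(d)` — the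
*unit-linear Frobenius functor* — which (a) acts as the identity on objects and isometries and (b) is
`1`-compatible, relative to `C → F_Φ` and `C(d) → F_{d·Φ} ⊆ F_Φ`, with the Frobenius functor
associated to `d` on `F_Φ`.  (An earlier draft quantified over an arbitrary endomorphism `δ` of `Φ`;
that is false for non-injective `δ` — audit RQ7-L1t2-F1.) [cite: MochizukiFrdI2008, Prop. 2.5(iii) p.49] -/
def UnitLinearFrobeniusExists (d : ℕ+) : Prop :=
  ∀ (_τ : CharacteristicSplitting F), IsFrobenioid F → IsOfType (IsFrobeniusNormalized F) →
    IsOfType (IsMetricallyTrivial F) → IsOfType (IsAutAmple F) →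
      ∃ U : UnitLinearFrobeniusData F (powEnd Φ d), U.functor.IsEquivalence ∧
        OneCommutes U.functor (wideSubcategoryInclusion (divIn F (powEnd Φ d)) ⋙ F) F
          (ElemFrobenioid.frobenius Φ d)

/-- **Prop. 2.5 (iii)**, bracket (statement, `Λ = ℤ` case): "[… `C(d)`, equipped with the natural
functor `C(d) → F_{d·Φ}`, is a Frobenioid]". [cite: MochizukiFrdI2008, Prop. 2.5(iii) p.49] -/
def CdIsFrobenioid (d : ℕ+) : Prop :=
  ∀ (_τ : CharacteristicSplitting F), IsFrobenioid F → IsOfType (IsFrobeniusNormalized F) →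
    IsOfType (IsMetricallyTrivial F) → IsOfType (IsAutAmple F) → IsFrobenioid (cdToElem F (powEnd Φ d))

/-! ### Corollary 2.6: unit-wise Frobenius functors I -/

/-- **Cor. 2.6** (statement): for a characteristic splitting `τ`, `d ∈ ℕ_{≥1}` and `C` of
Frobenius-normalized, metrically trivial and `Aut`-ample type, there exists a functor `Ψ : C → C`
— the *unit-wise Frobenius functor* — such that (a) `Ψ` is `1`-compatible, relative to `C → F_Φ`,
with the identity functor on `F_Φ`; (b) `Ψ` maps an object (resp. morphism of Frobenius type;
pre-step; pull-back morphism) of `C^istr` to an isomorphic object (resp. abstractly equivalent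
morphism); (c) for `A ∈ Ob(C^istr)` there is an isomorphism `Ψ(A) ≅ A` conjugating the endomorphism
of `O^×(A)` induced by `Ψ` into the `d`-th power map; (d) if `C` is of perfect type `Ψ` is an
equivalence, and if `d = 1` or `C` is of isotropic and unit-trivial type then `Ψ ≅ id`.
[cite: MochizukiFrdI2008, Cor. 2.6 p.50] -/
def UnitWiseFrobeniusExists (d : ℕ+) : Prop :=
  ∀ (_τ : CharacteristicSplitting F), IsFrobenioid F → IsOfType (IsFrobeniusNormalized F) →
    IsOfType (IsMetricallyTrivial F) → IsOfType (IsAutAmple F) →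
      ∃ Ψ : C ⥤ C,
        -- (a)
        OneCommutes Ψ F F (𝟭 (ElemFrobenioid Φ)) ∧
        -- (b)
        (∀ A : C, IsIsotropic F A → Nonempty (Ψ.obj A ≅ A)) ∧
        (∀ {A B : C} (φ : A ⟶ B), IsIsotropic F A → IsIsotropic F B →
          (IsFrobeniusType F φ ∨ IsPreStep F φ ∨ IsPullbackMorphism F φ) →
            IsAbstractlyEquivalent (Ψ.map φ) φ) ∧
        -- (c)
        (∀ A : C, IsIsotropic F A → ∃ e : Ψ.obj A ≅ A, ∀ u ∈ unitsSubgroup F A,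
          e.inv ≫ Ψ.map u.hom ≫ e.hom = (u ^ (d : ℕ)).hom) ∧
        -- (d)
        (IsOfPerfectType F → Ψ.IsEquivalence) ∧
        ((d = 1 ∨ (IsOfIsotropicType F ∧ IsOfType (IsUnitTrivial F))) → Nonempty (Ψ ≅ 𝟭 C))

end PreFrobenioid

end Literature.AlgebraicGeometry.Frobenioids
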